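import Summits.BirchSwinnertonDyer.BirchSwinnertonDyer.Theorems.BiquadraticEisensteinDescentHeegnerTwistCouplingInSupplyKrizLiCornerQT27
import Summits.BirchSwinnertonDyer.BirchSwinnertonDyer.Theorems.PrintCFramJZeroThreeUnitRegimePrimePairInstances
import Literature.NumberTheory.QuadraticFields.ImaginaryQuadraticClassNumberValues
import HarnessLib

set_option linter.dupNamespace false -- `Summit.BirchSwinnertonDyer.BirchSwinnertonDyer.Theorems.…` (summit = sub, D-0017)
set_option autoImplicit false

/-!
# Crux `HeegnerTwistCouplingInSupply` (stmt-BirchSwinnertonDyer-21381) — QT27₊ through the Kriz–Li door, TABLE II: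
# every KL3-regular prime `q ≡ 5 (mod 12)` with 500 < q ≤ 701 — `q ∈ {509, 557, 569, 593, 617, 641, 677, 701}`

Route `BiquadraticEisensteinDescent` (cell `pub/bsd-wall`, width seat `bsd-wall-cm-bed-w4` g27; `--supports` 21381, helper). Companion of
`…KrizLiCornerQT27.lean` (`exists_cruxConclusion_of_prime_pair`) / `…KrizLiCornerQT27Instances.lean` (q < 110). For each row ONE certificate prime `r ≡ 11 (mod 12)` with
`(−r/q) = +1`, `3 ∤ h(−qr)`, `h(−r) < q` (this seat's `work/py/qt27_rows2.py`), the two integer certificates `3 ∤ S₁(q,r)`, `3 ∥ S₂(q)` of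
Kriz–Li's Bernoulli hypothesis DECIDED in the kernel (Euler's criterion in `ℕ`, `RouteU.jacobiSym_prime_eq_ite_nat`; the largest sum here
has 58183 terms), and ★ `cruxOnQT27Plus_<q>`: the CONCLUSION of crux 21381 at `(W, q)` for every globally minimal
`W ≅ y² = x³ + q·m²` (bad primes `⊂ {3, q}`, `a₂ = 0` if good at `2`, `r_an(W) ≠ 0`) modulo the three named facts `hKL` (Kriz–Li 2019 Thm.
1.20), `hGZ` (Gross–Zagier), `hHP` (Heegner points). KL3-IRREGULAR `q ≡ 5 (12)` below `1000` (`3 ∣ h(−3q)`, corner void for this door):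
29, 113, 137, 173, 257, 281, 353, 401, 449, 461, 521, 653, 761, 773, 929, 953.

| `q` | `r` | `h(−r)` | terms of `S₁` |
|---|---|---|---|
| 509 | 11 | 1 | 5599 |
| 557 | 71 | 7 | 39547 |
| 569 | 71 | 7 | 40399 |
| 593 | 23 | 3 | 13639 |
| 617 | 47 | 5 | 28999 |
| 641 | 11 | 1 | 7051 |
| 677 | 59 | 3 | 39943 |
| 701 | 83 | 3 | 58183 |

HONEST FRAMING: cells of ONE CM family; conditional on three REFEREED named facts; per-curve binders `hW`/`h6`/`h2`/`hS` displayed as in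
the cell `bsd-print-cfram`'s class theorems; the crux (C⁺ / (S3′)(p) for all `p`), its registered stubs and BSD are NOT proved by any of
this. THEOREMS ONLY. Supports stmt-BirchSwinnertonDyer-21381.
[cite: KrizLi2019, Thm. 1.20 (pp. 7–8), §1.5 (1)] [cite: Washington1997, Thm. 4.2] [cite: GrossZagier1986, Thm. I.(6.3), V.§1–2]
[cite: Cox2013, §2.A Thm. 2.13; §7.B Thm. 7.7(ii)] [cite: IrelandRosen1990, Prop. 5.1.2 (Euler's criterion)]
-/

noncomputable section

open scoped Classical

namespace Summit.BirchSwinnertonDyer.BirchSwinnertonDyer.Theorems.KrizLiCornerQT27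

open _root_.WeierstrassCurve NumberField
open Literature.NumberTheory.EllipticCurves Literature.NumberTheory.EllipticCurves.KrizLi2019
  Literature.NumberTheory.EllipticCurves.ModularForms Literature.NumberTheory.QuadraticFields
  Literature.NumberTheory.QuadraticFields.Quadratic
  Summit.BirchSwinnertonDyer.Rank1Residual.X12.O11.RouteU
  Summit.BirchSwinnertonDyer.BirchSwinnertonDyer.Theorems.PrintCFram

/-! ## `(q, r) = (509, 11)` -/

set_option maxRecDepth 800000 in
/-- **CERTIFICATES for `(q, r) = (509, 11)`**: `3 ∤ S₁(509,11)` (5599 terms), `3 ∣ S₂(509)`, `9 ∤ S₂(509)` (`decide +kernel` on Euler's criterion).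
[cite: KrizLi2019, Thm. 1.20 (p. 8) and §1.5 (1)] [cite: Washington1997, Thm. 4.2] -/
theorem cert_509_11 :
    ¬ ((3 : ℤ) ∣ ∑ j ∈ Finset.range (509 * 11), jacobiSym (j : ℤ) 509 * jacobiSym (j : ℤ) 11 * (j : ℤ)) ∧
    ((3 : ℤ) ∣ ∑ j ∈ Finset.range (509 * 3), jacobiSym (j : ℤ) 509 * jacobiSym (j : ℤ) 3 * (j : ℤ) ^ (0 + 1)) ∧
    ¬ ((3 : ℤ) ^ 2 ∣ ∑ j ∈ Finset.range (509 * 3), jacobiSym (j : ℤ) 509 * jacobiSym (j : ℤ) 3 * (j : ℤ) ^ (0 + 1)) := by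
  simp_rw [jacobiSym_prime_eq_ite_nat 509 (by norm_num) (by norm_num), jacobiSym_prime_eq_ite_nat 11 (by norm_num) (by norm_num),
    jacobiSym_prime_eq_ite_nat 3 (by norm_num) (by norm_num)]
  refine ⟨?_, ?_, ?_⟩ <;> decide +kernel

/-- ★ **The QT27₊ corner at `q = 509`** (certificate `r = 11`, `h(−11) = 1 < 509`): for every globally minimal `W ≅ y² = x³ + 509·m²`
(`509m²` sixth-power-free; `27a^{(509)}` is `m = 2036`) with bad primes `⊂ {3, 509}`, `a₂(W) = 0` if good at `2`, `r_an(W) ≠ 0`: the CONCLUSION of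
crux 21381 at `(W, 509)`, modulo `hKL`, `hGZ`, `hHP` only. [cite: KrizLi2019, Thm. 1.20 (pp. 7–8)] [cite: GrossZagier1986, Thm. I.(6.3), V.§1–2] -/
theorem cruxOnQT27Plus_509 (hKL : thm120_padicLogHeegner_unit_of_bernoulli)
    (hGZ : ∀ (N : ℕ) [NeZero N] (W : WeierstrassCurve ℚ) (K : Type) [Field K] [NumberField K], gross_zagier N W K)
    (hHP : ∀ (W : WeierstrassCurve ℚ) (K : Type) [Field K] [NumberField K], exists_isHeegnerPoint W K)
    (W : WeierstrassCurve ℚ) [W.IsElliptic] [W.IsGloballyMinimal] [NeZero (W.conductorNorm ℤ)]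
    {m : ℤ} (hm : m ≠ 0) (hW : ∃ C : VariableChange ℚ, C • W = mordellCurve ((509 : ℚ) * (m : ℚ) ^ 2))
    (h6 : ∀ ℓ : ℕ, ℓ.Prime → ¬ ((ℓ : ℤ) ^ 6 ∣ (509 : ℤ) * m ^ 2))
    (h2 : (haveI : Fact (Nat.Prime 2) := ⟨Nat.prime_two⟩; W.HasGoodReductionAtPrime 2) → W.LFunction 2 = 0)
    (hS : ∀ ℓ : ℕ, (hℓ : ℓ.Prime) → ¬ (haveI := Fact.mk hℓ; W.HasGoodReductionAtPrime ℓ) → ℓ = 3 ∨ ℓ = 509)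
    (hr1 : W.analyticRank ≠ 0) :
    ∃ (K : Type) (_ : Field K) (_ : NumberField K),
      IsImaginaryQuadratic K ∧ 4 < (NumberField.discr K).natAbs ∧
      SatisfiesHeegnerHypothesis (W.conductorNorm ℤ) K ∧
      (W.quadraticTwist (NumberField.discr K : ℚ)).entireLFunction 1 ≠ 0 ∧ ¬ 509 ∣ NumberField.classNumber K := by
  haveI : Fact (Nat.Prime 509) := ⟨by norm_num⟩
  haveI : Fact (Nat.Prime 11) := ⟨by norm_num⟩
  exact exists_cruxConclusion_of_prime_pair hKL hGZ hHP (q := 509) (r := 11) (by norm_num) (by norm_num) (by norm_num)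
    (by norm_num) (by norm_num) (by norm_num)
    (by simp_rw [jacobiSym.legendreSym.to_jacobiSym]; exact cert_509_11.1)
    (by simp_rw [jacobiSym.legendreSym.to_jacobiSym]; exact cert_509_11.2.1)
    (by simp_rw [jacobiSym.legendreSym.to_jacobiSym]; exact cert_509_11.2.2)
    ClassNumberValues.classNumber_neg11 (by norm_num) W hm (by exact_mod_cast hW) (by exact_mod_cast h6) h2
    (fun ℓ hℓ hbad => (hS ℓ hℓ hbad).elim Or.inl fun h => Or.inr (Or.inl h)) hr1

/-! ## `(q, r) = (557, 71)` -/

set_option maxRecDepth 800000 in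
/-- **CERTIFICATES for `(q, r) = (557, 71)`**: `3 ∤ S₁(557,71)` (39547 terms), `3 ∣ S₂(557)`, `9 ∤ S₂(557)` (`decide +kernel` on Euler's criterion).
[cite: KrizLi2019, Thm. 1.20 (p. 8) and §1.5 (1)] [cite: Washington1997, Thm. 4.2] -/
theorem cert_557_71 :
    ¬ ((3 : ℤ) ∣ ∑ j ∈ Finset.range (557 * 71), jacobiSym (j : ℤ) 557 * jacobiSym (j : ℤ) 71 * (j : ℤ)) ∧
    ((3 : ℤ) ∣ ∑ j ∈ Finset.range (557 * 3), jacobiSym (j : ℤ) 557 * jacobiSym (j : ℤ) 3 * (j : ℤ) ^ (0 + 1)) ∧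
    ¬ ((3 : ℤ) ^ 2 ∣ ∑ j ∈ Finset.range (557 * 3), jacobiSym (j : ℤ) 557 * jacobiSym (j : ℤ) 3 * (j : ℤ) ^ (0 + 1)) := by
  simp_rw [jacobiSym_prime_eq_ite_nat 557 (by norm_num) (by norm_num), jacobiSym_prime_eq_ite_nat 71 (by norm_num) (by norm_num),
    jacobiSym_prime_eq_ite_nat 3 (by norm_num) (by norm_num)]
  refine ⟨?_, ?_, ?_⟩ <;> decide +kernel

/-- ★ **The QT27₊ corner at `q = 557`** (certificate `r = 71`, `h(−71) = 7 < 557`): for every globally minimal `W ≅ y² = x³ + 557·m²`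
(`557m²` sixth-power-free; `27a^{(557)}` is `m = 2228`) with bad primes `⊂ {3, 557}`, `a₂(W) = 0` if good at `2`, `r_an(W) ≠ 0`: the CONCLUSION of
crux 21381 at `(W, 557)`, modulo `hKL`, `hGZ`, `hHP` only. [cite: KrizLi2019, Thm. 1.20 (pp. 7–8)] [cite: GrossZagier1986, Thm. I.(6.3), V.§1–2] -/
theorem cruxOnQT27Plus_557 (hKL : thm120_padicLogHeegner_unit_of_bernoulli)
    (hGZ : ∀ (N : ℕ) [NeZero N] (W : WeierstrassCurve ℚ) (K : Type) [Field K] [NumberField K], gross_zagier N W K)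
    (hHP : ∀ (W : WeierstrassCurve ℚ) (K : Type) [Field K] [NumberField K], exists_isHeegnerPoint W K)
    (W : WeierstrassCurve ℚ) [W.IsElliptic] [W.IsGloballyMinimal] [NeZero (W.conductorNorm ℤ)]
    {m : ℤ} (hm : m ≠ 0) (hW : ∃ C : VariableChange ℚ, C • W = mordellCurve ((557 : ℚ) * (m : ℚ) ^ 2))
    (h6 : ∀ ℓ : ℕ, ℓ.Prime → ¬ ((ℓ : ℤ) ^ 6 ∣ (557 : ℤ) * m ^ 2))
    (h2 : (haveI : Fact (Nat.Prime 2) := ⟨Nat.prime_two⟩; W.HasGoodReductionAtPrime 2) → W.LFunction 2 = 0)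
    (hS : ∀ ℓ : ℕ, (hℓ : ℓ.Prime) → ¬ (haveI := Fact.mk hℓ; W.HasGoodReductionAtPrime ℓ) → ℓ = 3 ∨ ℓ = 557)
    (hr1 : W.analyticRank ≠ 0) :
    ∃ (K : Type) (_ : Field K) (_ : NumberField K),
      IsImaginaryQuadratic K ∧ 4 < (NumberField.discr K).natAbs ∧
      SatisfiesHeegnerHypothesis (W.conductorNorm ℤ) K ∧
      (W.quadraticTwist (NumberField.discr K : ℚ)).entireLFunction 1 ≠ 0 ∧ ¬ 557 ∣ NumberField.classNumber K := by
  haveI : Fact (Nat.Prime 557) := ⟨by norm_num⟩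
  haveI : Fact (Nat.Prime 71) := ⟨by norm_num⟩
  exact exists_cruxConclusion_of_prime_pair hKL hGZ hHP (q := 557) (r := 71) (by norm_num) (by norm_num) (by norm_num)
    (by norm_num) (by norm_num) (by norm_num)
    (by simp_rw [jacobiSym.legendreSym.to_jacobiSym]; exact cert_557_71.1)
    (by simp_rw [jacobiSym.legendreSym.to_jacobiSym]; exact cert_557_71.2.1)
    (by simp_rw [jacobiSym.legendreSym.to_jacobiSym]; exact cert_557_71.2.2)
    ClassNumberValues.classNumber_neg71 (by norm_num) W hm (by exact_mod_cast hW) (by exact_mod_cast h6) h2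
    (fun ℓ hℓ hbad => (hS ℓ hℓ hbad).elim Or.inl fun h => Or.inr (Or.inl h)) hr1

/-! ## `(q, r) = (569, 71)` -/

set_option maxRecDepth 800000 in
/-- **CERTIFICATES for `(q, r) = (569, 71)`**: `3 ∤ S₁(569,71)` (40399 terms), `3 ∣ S₂(569)`, `9 ∤ S₂(569)` (`decide +kernel` on Euler's criterion).
[cite: KrizLi2019, Thm. 1.20 (p. 8) and §1.5 (1)] [cite: Washington1997, Thm. 4.2] -/
theorem cert_569_71 :
    ¬ ((3 : ℤ) ∣ ∑ j ∈ Finset.range (569 * 71), jacobiSym (j : ℤ) 569 * jacobiSym (j : ℤ) 71 * (j : ℤ)) ∧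
    ((3 : ℤ) ∣ ∑ j ∈ Finset.range (569 * 3), jacobiSym (j : ℤ) 569 * jacobiSym (j : ℤ) 3 * (j : ℤ) ^ (0 + 1)) ∧
    ¬ ((3 : ℤ) ^ 2 ∣ ∑ j ∈ Finset.range (569 * 3), jacobiSym (j : ℤ) 569 * jacobiSym (j : ℤ) 3 * (j : ℤ) ^ (0 + 1)) := by
  simp_rw [jacobiSym_prime_eq_ite_nat 569 (by norm_num) (by norm_num), jacobiSym_prime_eq_ite_nat 71 (by norm_num) (by norm_num),
    jacobiSym_prime_eq_ite_nat 3 (by norm_num) (by norm_num)]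
  refine ⟨?_, ?_, ?_⟩ <;> decide +kernel

/-- ★ **The QT27₊ corner at `q = 569`** (certificate `r = 71`, `h(−71) = 7 < 569`): for every globally minimal `W ≅ y² = x³ + 569·m²`
(`569m²` sixth-power-free; `27a^{(569)}` is `m = 2276`) with bad primes `⊂ {3, 569}`, `a₂(W) = 0` if good at `2`, `r_an(W) ≠ 0`: the CONCLUSION of
crux 21381 at `(W, 569)`, modulo `hKL`, `hGZ`, `hHP` only. [cite: KrizLi2019, Thm. 1.20 (pp. 7–8)] [cite: GrossZagier1986, Thm. I.(6.3), V.§1–2] -/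
theorem cruxOnQT27Plus_569 (hKL : thm120_padicLogHeegner_unit_of_bernoulli)
    (hGZ : ∀ (N : ℕ) [NeZero N] (W : WeierstrassCurve ℚ) (K : Type) [Field K] [NumberField K], gross_zagier N W K)
    (hHP : ∀ (W : WeierstrassCurve ℚ) (K : Type) [Field K] [NumberField K], exists_isHeegnerPoint W K)
    (W : WeierstrassCurve ℚ) [W.IsElliptic] [W.IsGloballyMinimal] [NeZero (W.conductorNorm ℤ)]
    {m : ℤ} (hm : m ≠ 0) (hW : ∃ C : VariableChange ℚ, C • W = mordellCurve ((569 : ℚ) * (m : ℚ) ^ 2))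
    (h6 : ∀ ℓ : ℕ, ℓ.Prime → ¬ ((ℓ : ℤ) ^ 6 ∣ (569 : ℤ) * m ^ 2))
    (h2 : (haveI : Fact (Nat.Prime 2) := ⟨Nat.prime_two⟩; W.HasGoodReductionAtPrime 2) → W.LFunction 2 = 0)
    (hS : ∀ ℓ : ℕ, (hℓ : ℓ.Prime) → ¬ (haveI := Fact.mk hℓ; W.HasGoodReductionAtPrime ℓ) → ℓ = 3 ∨ ℓ = 569)
    (hr1 : W.analyticRank ≠ 0) :
    ∃ (K : Type) (_ : Field K) (_ : NumberField K),
      IsImaginaryQuadratic K ∧ 4 < (NumberField.discr K).natAbs ∧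
      SatisfiesHeegnerHypothesis (W.conductorNorm ℤ) K ∧
      (W.quadraticTwist (NumberField.discr K : ℚ)).entireLFunction 1 ≠ 0 ∧ ¬ 569 ∣ NumberField.classNumber K := by
  haveI : Fact (Nat.Prime 569) := ⟨by norm_num⟩
  haveI : Fact (Nat.Prime 71) := ⟨by norm_num⟩
  exact exists_cruxConclusion_of_prime_pair hKL hGZ hHP (q := 569) (r := 71) (by norm_num) (by norm_num) (by norm_num)
    (by norm_num) (by norm_num) (by norm_num)
    (by simp_rw [jacobiSym.legendreSym.to_jacobiSym]; exact cert_569_71.1)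
    (by simp_rw [jacobiSym.legendreSym.to_jacobiSym]; exact cert_569_71.2.1)
    (by simp_rw [jacobiSym.legendreSym.to_jacobiSym]; exact cert_569_71.2.2)
    ClassNumberValues.classNumber_neg71 (by norm_num) W hm (by exact_mod_cast hW) (by exact_mod_cast h6) h2
    (fun ℓ hℓ hbad => (hS ℓ hℓ hbad).elim Or.inl fun h => Or.inr (Or.inl h)) hr1

/-! ## `(q, r) = (593, 23)` -/

set_option maxRecDepth 800000 in
/-- **CERTIFICATES for `(q, r) = (593, 23)`**: `3 ∤ S₁(593,23)` (13639 terms), `3 ∣ S₂(593)`, `9 ∤ S₂(593)` (`decide +kernel` on Euler's criterion).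
[cite: KrizLi2019, Thm. 1.20 (p. 8) and §1.5 (1)] [cite: Washington1997, Thm. 4.2] -/
theorem cert_593_23 :
    ¬ ((3 : ℤ) ∣ ∑ j ∈ Finset.range (593 * 23), jacobiSym (j : ℤ) 593 * jacobiSym (j : ℤ) 23 * (j : ℤ)) ∧
    ((3 : ℤ) ∣ ∑ j ∈ Finset.range (593 * 3), jacobiSym (j : ℤ) 593 * jacobiSym (j : ℤ) 3 * (j : ℤ) ^ (0 + 1)) ∧
    ¬ ((3 : ℤ) ^ 2 ∣ ∑ j ∈ Finset.range (593 * 3), jacobiSym (j : ℤ) 593 * jacobiSym (j : ℤ) 3 * (j : ℤ) ^ (0 + 1)) := by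
  simp_rw [jacobiSym_prime_eq_ite_nat 593 (by norm_num) (by norm_num), jacobiSym_prime_eq_ite_nat 23 (by norm_num) (by norm_num),
    jacobiSym_prime_eq_ite_nat 3 (by norm_num) (by norm_num)]
  refine ⟨?_, ?_, ?_⟩ <;> decide +kernel

/-- ★ **The QT27₊ corner at `q = 593`** (certificate `r = 23`, `h(−23) = 3 < 593`): for every globally minimal `W ≅ y² = x³ + 593·m²`
(`593m²` sixth-power-free; `27a^{(593)}` is `m = 2372`) with bad primes `⊂ {3, 593}`, `a₂(W) = 0` if good at `2`, `r_an(W) ≠ 0`: the CONCLUSION of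
crux 21381 at `(W, 593)`, modulo `hKL`, `hGZ`, `hHP` only. [cite: KrizLi2019, Thm. 1.20 (pp. 7–8)] [cite: GrossZagier1986, Thm. I.(6.3), V.§1–2] -/
theorem cruxOnQT27Plus_593 (hKL : thm120_padicLogHeegner_unit_of_bernoulli)
    (hGZ : ∀ (N : ℕ) [NeZero N] (W : WeierstrassCurve ℚ) (K : Type) [Field K] [NumberField K], gross_zagier N W K)
    (hHP : ∀ (W : WeierstrassCurve ℚ) (K : Type) [Field K] [NumberField K], exists_isHeegnerPoint W K)
    (W : WeierstrassCurve ℚ) [W.IsElliptic] [W.IsGloballyMinimal] [NeZero (W.conductorNorm ℤ)]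
    {m : ℤ} (hm : m ≠ 0) (hW : ∃ C : VariableChange ℚ, C • W = mordellCurve ((593 : ℚ) * (m : ℚ) ^ 2))
    (h6 : ∀ ℓ : ℕ, ℓ.Prime → ¬ ((ℓ : ℤ) ^ 6 ∣ (593 : ℤ) * m ^ 2))
    (h2 : (haveI : Fact (Nat.Prime 2) := ⟨Nat.prime_two⟩; W.HasGoodReductionAtPrime 2) → W.LFunction 2 = 0)
    (hS : ∀ ℓ : ℕ, (hℓ : ℓ.Prime) → ¬ (haveI := Fact.mk hℓ; W.HasGoodReductionAtPrime ℓ) → ℓ = 3 ∨ ℓ = 593)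
    (hr1 : W.analyticRank ≠ 0) :
    ∃ (K : Type) (_ : Field K) (_ : NumberField K),
      IsImaginaryQuadratic K ∧ 4 < (NumberField.discr K).natAbs ∧
      SatisfiesHeegnerHypothesis (W.conductorNorm ℤ) K ∧
      (W.quadraticTwist (NumberField.discr K : ℚ)).entireLFunction 1 ≠ 0 ∧ ¬ 593 ∣ NumberField.classNumber K := by
  haveI : Fact (Nat.Prime 593) := ⟨by norm_num⟩
  haveI : Fact (Nat.Prime 23) := ⟨by norm_num⟩
  exact exists_cruxConclusion_of_prime_pair hKL hGZ hHP (q := 593) (r := 23) (by norm_num) (by norm_num) (by norm_num)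
    (by norm_num) (by norm_num) (by norm_num)
    (by simp_rw [jacobiSym.legendreSym.to_jacobiSym]; exact cert_593_23.1)
    (by simp_rw [jacobiSym.legendreSym.to_jacobiSym]; exact cert_593_23.2.1)
    (by simp_rw [jacobiSym.legendreSym.to_jacobiSym]; exact cert_593_23.2.2)
    ClassNumberValues.classNumber_neg23 (by norm_num) W hm (by exact_mod_cast hW) (by exact_mod_cast h6) h2
    (fun ℓ hℓ hbad => (hS ℓ hℓ hbad).elim Or.inl fun h => Or.inr (Or.inl h)) hr1

/-! ## `(q, r) = (617, 47)` -/

set_option maxRecDepth 800000 in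
/-- **CERTIFICATES for `(q, r) = (617, 47)`**: `3 ∤ S₁(617,47)` (28999 terms), `3 ∣ S₂(617)`, `9 ∤ S₂(617)` (`decide +kernel` on Euler's criterion).
[cite: KrizLi2019, Thm. 1.20 (p. 8) and §1.5 (1)] [cite: Washington1997, Thm. 4.2] -/
theorem cert_617_47 :
    ¬ ((3 : ℤ) ∣ ∑ j ∈ Finset.range (617 * 47), jacobiSym (j : ℤ) 617 * jacobiSym (j : ℤ) 47 * (j : ℤ)) ∧
    ((3 : ℤ) ∣ ∑ j ∈ Finset.range (617 * 3), jacobiSym (j : ℤ) 617 * jacobiSym (j : ℤ) 3 * (j : ℤ) ^ (0 + 1)) ∧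
    ¬ ((3 : ℤ) ^ 2 ∣ ∑ j ∈ Finset.range (617 * 3), jacobiSym (j : ℤ) 617 * jacobiSym (j : ℤ) 3 * (j : ℤ) ^ (0 + 1)) := by
  simp_rw [jacobiSym_prime_eq_ite_nat 617 (by norm_num) (by norm_num), jacobiSym_prime_eq_ite_nat 47 (by norm_num) (by norm_num),
    jacobiSym_prime_eq_ite_nat 3 (by norm_num) (by norm_num)]
  refine ⟨?_, ?_, ?_⟩ <;> decide +kernel

/-- ★ **The QT27₊ corner at `q = 617`** (certificate `r = 47`, `h(−47) = 5 < 617`): for every globally minimal `W ≅ y² = x³ + 617·m²`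
(`617m²` sixth-power-free; `27a^{(617)}` is `m = 2468`) with bad primes `⊂ {3, 617}`, `a₂(W) = 0` if good at `2`, `r_an(W) ≠ 0`: the CONCLUSION of
crux 21381 at `(W, 617)`, modulo `hKL`, `hGZ`, `hHP` only. [cite: KrizLi2019, Thm. 1.20 (pp. 7–8)] [cite: GrossZagier1986, Thm. I.(6.3), V.§1–2] -/
theorem cruxOnQT27Plus_617 (hKL : thm120_padicLogHeegner_unit_of_bernoulli)
    (hGZ : ∀ (N : ℕ) [NeZero N] (W : WeierstrassCurve ℚ) (K : Type) [Field K] [NumberField K], gross_zagier N W K)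
    (hHP : ∀ (W : WeierstrassCurve ℚ) (K : Type) [Field K] [NumberField K], exists_isHeegnerPoint W K)
    (W : WeierstrassCurve ℚ) [W.IsElliptic] [W.IsGloballyMinimal] [NeZero (W.conductorNorm ℤ)]
    {m : ℤ} (hm : m ≠ 0) (hW : ∃ C : VariableChange ℚ, C • W = mordellCurve ((617 : ℚ) * (m : ℚ) ^ 2))
    (h6 : ∀ ℓ : ℕ, ℓ.Prime → ¬ ((ℓ : ℤ) ^ 6 ∣ (617 : ℤ) * m ^ 2))
    (h2 : (haveI : Fact (Nat.Prime 2) := ⟨Nat.prime_two⟩; W.HasGoodReductionAtPrime 2) → W.LFunction 2 = 0)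
    (hS : ∀ ℓ : ℕ, (hℓ : ℓ.Prime) → ¬ (haveI := Fact.mk hℓ; W.HasGoodReductionAtPrime ℓ) → ℓ = 3 ∨ ℓ = 617)
    (hr1 : W.analyticRank ≠ 0) :
    ∃ (K : Type) (_ : Field K) (_ : NumberField K),
      IsImaginaryQuadratic K ∧ 4 < (NumberField.discr K).natAbs ∧
      SatisfiesHeegnerHypothesis (W.conductorNorm ℤ) K ∧
      (W.quadraticTwist (NumberField.discr K : ℚ)).entireLFunction 1 ≠ 0 ∧ ¬ 617 ∣ NumberField.classNumber K := by
  haveI : Fact (Nat.Prime 617) := ⟨by norm_num⟩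
  haveI : Fact (Nat.Prime 47) := ⟨by norm_num⟩
  exact exists_cruxConclusion_of_prime_pair hKL hGZ hHP (q := 617) (r := 47) (by norm_num) (by norm_num) (by norm_num)
    (by norm_num) (by norm_num) (by norm_num)
    (by simp_rw [jacobiSym.legendreSym.to_jacobiSym]; exact cert_617_47.1)
    (by simp_rw [jacobiSym.legendreSym.to_jacobiSym]; exact cert_617_47.2.1)
    (by simp_rw [jacobiSym.legendreSym.to_jacobiSym]; exact cert_617_47.2.2)
    ClassNumberValues.classNumber_neg47 (by norm_num) W hm (by exact_mod_cast hW) (by exact_mod_cast h6) h2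
    (fun ℓ hℓ hbad => (hS ℓ hℓ hbad).elim Or.inl fun h => Or.inr (Or.inl h)) hr1

/-! ## `(q, r) = (641, 11)` -/

set_option maxRecDepth 800000 in
/-- **CERTIFICATES for `(q, r) = (641, 11)`**: `3 ∤ S₁(641,11)` (7051 terms), `3 ∣ S₂(641)`, `9 ∤ S₂(641)` (`decide +kernel` on Euler's criterion).
[cite: KrizLi2019, Thm. 1.20 (p. 8) and §1.5 (1)] [cite: Washington1997, Thm. 4.2] -/
theorem cert_641_11 :
    ¬ ((3 : ℤ) ∣ ∑ j ∈ Finset.range (641 * 11), jacobiSym (j : ℤ) 641 * jacobiSym (j : ℤ) 11 * (j : ℤ)) ∧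
    ((3 : ℤ) ∣ ∑ j ∈ Finset.range (641 * 3), jacobiSym (j : ℤ) 641 * jacobiSym (j : ℤ) 3 * (j : ℤ) ^ (0 + 1)) ∧
    ¬ ((3 : ℤ) ^ 2 ∣ ∑ j ∈ Finset.range (641 * 3), jacobiSym (j : ℤ) 641 * jacobiSym (j : ℤ) 3 * (j : ℤ) ^ (0 + 1)) := by
  simp_rw [jacobiSym_prime_eq_ite_nat 641 (by norm_num) (by norm_num), jacobiSym_prime_eq_ite_nat 11 (by norm_num) (by norm_num),
    jacobiSym_prime_eq_ite_nat 3 (by norm_num) (by norm_num)]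
  refine ⟨?_, ?_, ?_⟩ <;> decide +kernel

/-- ★ **The QT27₊ corner at `q = 641`** (certificate `r = 11`, `h(−11) = 1 < 641`): for every globally minimal `W ≅ y² = x³ + 641·m²`
(`641m²` sixth-power-free; `27a^{(641)}` is `m = 2564`) with bad primes `⊂ {3, 641}`, `a₂(W) = 0` if good at `2`, `r_an(W) ≠ 0`: the CONCLUSION of
crux 21381 at `(W, 641)`, modulo `hKL`, `hGZ`, `hHP` only. [cite: KrizLi2019, Thm. 1.20 (pp. 7–8)] [cite: GrossZagier1986, Thm. I.(6.3), V.§1–2] -/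
theorem cruxOnQT27Plus_641 (hKL : thm120_padicLogHeegner_unit_of_bernoulli)
    (hGZ : ∀ (N : ℕ) [NeZero N] (W : WeierstrassCurve ℚ) (K : Type) [Field K] [NumberField K], gross_zagier N W K)
    (hHP : ∀ (W : WeierstrassCurve ℚ) (K : Type) [Field K] [NumberField K], exists_isHeegnerPoint W K)
    (W : WeierstrassCurve ℚ) [W.IsElliptic] [W.IsGloballyMinimal] [NeZero (W.conductorNorm ℤ)]
    {m : ℤ} (hm : m ≠ 0) (hW : ∃ C : VariableChange ℚ, C • W = mordellCurve ((641 : ℚ) * (m : ℚ) ^ 2))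
    (h6 : ∀ ℓ : ℕ, ℓ.Prime → ¬ ((ℓ : ℤ) ^ 6 ∣ (641 : ℤ) * m ^ 2))
    (h2 : (haveI : Fact (Nat.Prime 2) := ⟨Nat.prime_two⟩; W.HasGoodReductionAtPrime 2) → W.LFunction 2 = 0)
    (hS : ∀ ℓ : ℕ, (hℓ : ℓ.Prime) → ¬ (haveI := Fact.mk hℓ; W.HasGoodReductionAtPrime ℓ) → ℓ = 3 ∨ ℓ = 641)
    (hr1 : W.analyticRank ≠ 0) :
    ∃ (K : Type) (_ : Field K) (_ : NumberField K),
      IsImaginaryQuadratic K ∧ 4 < (NumberField.discr K).natAbs ∧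
      SatisfiesHeegnerHypothesis (W.conductorNorm ℤ) K ∧
      (W.quadraticTwist (NumberField.discr K : ℚ)).entireLFunction 1 ≠ 0 ∧ ¬ 641 ∣ NumberField.classNumber K := by
  haveI : Fact (Nat.Prime 641) := ⟨by norm_num⟩
  haveI : Fact (Nat.Prime 11) := ⟨by norm_num⟩
  exact exists_cruxConclusion_of_prime_pair hKL hGZ hHP (q := 641) (r := 11) (by norm_num) (by norm_num) (by norm_num)
    (by norm_num) (by norm_num) (by norm_num)
    (by simp_rw [jacobiSym.legendreSym.to_jacobiSym]; exact cert_641_11.1)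
    (by simp_rw [jacobiSym.legendreSym.to_jacobiSym]; exact cert_641_11.2.1)
    (by simp_rw [jacobiSym.legendreSym.to_jacobiSym]; exact cert_641_11.2.2)
    ClassNumberValues.classNumber_neg11 (by norm_num) W hm (by exact_mod_cast hW) (by exact_mod_cast h6) h2
    (fun ℓ hℓ hbad => (hS ℓ hℓ hbad).elim Or.inl fun h => Or.inr (Or.inl h)) hr1

/-! ## `(q, r) = (677, 59)` -/

set_option maxRecDepth 800000 in
/-- **CERTIFICATES for `(q, r) = (677, 59)`**: `3 ∤ S₁(677,59)` (39943 terms), `3 ∣ S₂(677)`, `9 ∤ S₂(677)` (`decide +kernel` on Euler's criterion).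
[cite: KrizLi2019, Thm. 1.20 (p. 8) and §1.5 (1)] [cite: Washington1997, Thm. 4.2] -/
theorem cert_677_59 :
    ¬ ((3 : ℤ) ∣ ∑ j ∈ Finset.range (677 * 59), jacobiSym (j : ℤ) 677 * jacobiSym (j : ℤ) 59 * (j : ℤ)) ∧
    ((3 : ℤ) ∣ ∑ j ∈ Finset.range (677 * 3), jacobiSym (j : ℤ) 677 * jacobiSym (j : ℤ) 3 * (j : ℤ) ^ (0 + 1)) ∧
    ¬ ((3 : ℤ) ^ 2 ∣ ∑ j ∈ Finset.range (677 * 3), jacobiSym (j : ℤ) 677 * jacobiSym (j : ℤ) 3 * (j : ℤ) ^ (0 + 1)) := by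
  simp_rw [jacobiSym_prime_eq_ite_nat 677 (by norm_num) (by norm_num), jacobiSym_prime_eq_ite_nat 59 (by norm_num) (by norm_num),
    jacobiSym_prime_eq_ite_nat 3 (by norm_num) (by norm_num)]
  refine ⟨?_, ?_, ?_⟩ <;> decide +kernel

/-- ★ **The QT27₊ corner at `q = 677`** (certificate `r = 59`, `h(−59) = 3 < 677`): for every globally minimal `W ≅ y² = x³ + 677·m²`
(`677m²` sixth-power-free; `27a^{(677)}` is `m = 2708`) with bad primes `⊂ {3, 677}`, `a₂(W) = 0` if good at `2`, `r_an(W) ≠ 0`: the CONCLUSION of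
crux 21381 at `(W, 677)`, modulo `hKL`, `hGZ`, `hHP` only. [cite: KrizLi2019, Thm. 1.20 (pp. 7–8)] [cite: GrossZagier1986, Thm. I.(6.3), V.§1–2] -/
theorem cruxOnQT27Plus_677 (hKL : thm120_padicLogHeegner_unit_of_bernoulli)
    (hGZ : ∀ (N : ℕ) [NeZero N] (W : WeierstrassCurve ℚ) (K : Type) [Field K] [NumberField K], gross_zagier N W K)
    (hHP : ∀ (W : WeierstrassCurve ℚ) (K : Type) [Field K] [NumberField K], exists_isHeegnerPoint W K)
    (W : WeierstrassCurve ℚ) [W.IsElliptic] [W.IsGloballyMinimal] [NeZero (W.conductorNorm ℤ)]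
    {m : ℤ} (hm : m ≠ 0) (hW : ∃ C : VariableChange ℚ, C • W = mordellCurve ((677 : ℚ) * (m : ℚ) ^ 2))
    (h6 : ∀ ℓ : ℕ, ℓ.Prime → ¬ ((ℓ : ℤ) ^ 6 ∣ (677 : ℤ) * m ^ 2))
    (h2 : (haveI : Fact (Nat.Prime 2) := ⟨Nat.prime_two⟩; W.HasGoodReductionAtPrime 2) → W.LFunction 2 = 0)
    (hS : ∀ ℓ : ℕ, (hℓ : ℓ.Prime) → ¬ (haveI := Fact.mk hℓ; W.HasGoodReductionAtPrime ℓ) → ℓ = 3 ∨ ℓ = 677)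
    (hr1 : W.analyticRank ≠ 0) :
    ∃ (K : Type) (_ : Field K) (_ : NumberField K),
      IsImaginaryQuadratic K ∧ 4 < (NumberField.discr K).natAbs ∧
      SatisfiesHeegnerHypothesis (W.conductorNorm ℤ) K ∧
      (W.quadraticTwist (NumberField.discr K : ℚ)).entireLFunction 1 ≠ 0 ∧ ¬ 677 ∣ NumberField.classNumber K := by
  haveI : Fact (Nat.Prime 677) := ⟨by norm_num⟩
  haveI : Fact (Nat.Prime 59) := ⟨by norm_num⟩
  exact exists_cruxConclusion_of_prime_pair hKL hGZ hHP (q := 677) (r := 59) (by norm_num) (by norm_num) (by norm_num)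
    (by norm_num) (by norm_num) (by norm_num)
    (by simp_rw [jacobiSym.legendreSym.to_jacobiSym]; exact cert_677_59.1)
    (by simp_rw [jacobiSym.legendreSym.to_jacobiSym]; exact cert_677_59.2.1)
    (by simp_rw [jacobiSym.legendreSym.to_jacobiSym]; exact cert_677_59.2.2)
    ClassNumberValues.classNumber_neg59 (by norm_num) W hm (by exact_mod_cast hW) (by exact_mod_cast h6) h2
    (fun ℓ hℓ hbad => (hS ℓ hℓ hbad).elim Or.inl fun h => Or.inr (Or.inl h)) hr1

/-! ## `(q, r) = (701, 83)` -/

set_option maxRecDepth 800000 in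
/-- **CERTIFICATES for `(q, r) = (701, 83)`**: `3 ∤ S₁(701,83)` (58183 terms), `3 ∣ S₂(701)`, `9 ∤ S₂(701)` (`decide +kernel` on Euler's criterion).
[cite: KrizLi2019, Thm. 1.20 (p. 8) and §1.5 (1)] [cite: Washington1997, Thm. 4.2] -/
theorem cert_701_83 :
    ¬ ((3 : ℤ) ∣ ∑ j ∈ Finset.range (701 * 83), jacobiSym (j : ℤ) 701 * jacobiSym (j : ℤ) 83 * (j : ℤ)) ∧
    ((3 : ℤ) ∣ ∑ j ∈ Finset.range (701 * 3), jacobiSym (j : ℤ) 701 * jacobiSym (j : ℤ) 3 * (j : ℤ) ^ (0 + 1)) ∧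
    ¬ ((3 : ℤ) ^ 2 ∣ ∑ j ∈ Finset.range (701 * 3), jacobiSym (j : ℤ) 701 * jacobiSym (j : ℤ) 3 * (j : ℤ) ^ (0 + 1)) := by
  simp_rw [jacobiSym_prime_eq_ite_nat 701 (by norm_num) (by norm_num), jacobiSym_prime_eq_ite_nat 83 (by norm_num) (by norm_num),
    jacobiSym_prime_eq_ite_nat 3 (by norm_num) (by norm_num)]
  refine ⟨?_, ?_, ?_⟩ <;> decide +kernel

/-- ★ **The QT27₊ corner at `q = 701`** (certificate `r = 83`, `h(−83) = 3 < 701`): for every globally minimal `W ≅ y² = x³ + 701·m²`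
(`701m²` sixth-power-free; `27a^{(701)}` is `m = 2804`) with bad primes `⊂ {3, 701}`, `a₂(W) = 0` if good at `2`, `r_an(W) ≠ 0`: the CONCLUSION of
crux 21381 at `(W, 701)`, modulo `hKL`, `hGZ`, `hHP` only. [cite: KrizLi2019, Thm. 1.20 (pp. 7–8)] [cite: GrossZagier1986, Thm. I.(6.3), V.§1–2] -/
theorem cruxOnQT27Plus_701 (hKL : thm120_padicLogHeegner_unit_of_bernoulli)
    (hGZ : ∀ (N : ℕ) [NeZero N] (W : WeierstrassCurve ℚ) (K : Type) [Field K] [NumberField K], gross_zagier N W K)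
    (hHP : ∀ (W : WeierstrassCurve ℚ) (K : Type) [Field K] [NumberField K], exists_isHeegnerPoint W K)
    (W : WeierstrassCurve ℚ) [W.IsElliptic] [W.IsGloballyMinimal] [NeZero (W.conductorNorm ℤ)]
    {m : ℤ} (hm : m ≠ 0) (hW : ∃ C : VariableChange ℚ, C • W = mordellCurve ((701 : ℚ) * (m : ℚ) ^ 2))
    (h6 : ∀ ℓ : ℕ, ℓ.Prime → ¬ ((ℓ : ℤ) ^ 6 ∣ (701 : ℤ) * m ^ 2))
    (h2 : (haveI : Fact (Nat.Prime 2) := ⟨Nat.prime_two⟩; W.HasGoodReductionAtPrime 2) → W.LFunction 2 = 0)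
    (hS : ∀ ℓ : ℕ, (hℓ : ℓ.Prime) → ¬ (haveI := Fact.mk hℓ; W.HasGoodReductionAtPrime ℓ) → ℓ = 3 ∨ ℓ = 701)
    (hr1 : W.analyticRank ≠ 0) :
    ∃ (K : Type) (_ : Field K) (_ : NumberField K),
      IsImaginaryQuadratic K ∧ 4 < (NumberField.discr K).natAbs ∧
      SatisfiesHeegnerHypothesis (W.conductorNorm ℤ) K ∧
      (W.quadraticTwist (NumberField.discr K : ℚ)).entireLFunction 1 ≠ 0 ∧ ¬ 701 ∣ NumberField.classNumber K := by
  haveI : Fact (Nat.Prime 701) := ⟨by norm_num⟩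
  haveI : Fact (Nat.Prime 83) := ⟨by norm_num⟩
  exact exists_cruxConclusion_of_prime_pair hKL hGZ hHP (q := 701) (r := 83) (by norm_num) (by norm_num) (by norm_num)
    (by norm_num) (by norm_num) (by norm_num)
    (by simp_rw [jacobiSym.legendreSym.to_jacobiSym]; exact cert_701_83.1)
    (by simp_rw [jacobiSym.legendreSym.to_jacobiSym]; exact cert_701_83.2.1)
    (by simp_rw [jacobiSym.legendreSym.to_jacobiSym]; exact cert_701_83.2.2)
    ClassNumberValues.classNumber_neg83 (by norm_num) W hm (by exact_mod_cast hW) (by exact_mod_cast h6) h2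
    (fun ℓ hℓ hbad => (hS ℓ hℓ hbad).elim Or.inl fun h => Or.inr (Or.inl h)) hr1

end Summit.BirchSwinnertonDyer.BirchSwinnertonDyer.Theorems.KrizLiCornerQT27

end
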